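import Summits.RiemannHypothesis.RiemannHypothesis.Theorems.IntegerScrewCensusFastNodes

/-!
# Route `IntegerScrew` — fast kernel arithmetic for manifest-certificate checks (11): SOUNDNESS (assembly)

`manifestCert_of_fastCheckB`: if the light test `fastLight n logs utab js oms WJ T CL CH` and the fast checker
`fastCheckB n logs utab js oms WJ CL CH` (`IntegerScrewCensusFastCheckB`) both return `true`, the log table encloses
`log m` (`m ≤ n+1`), the scaled-digit u-table is valid (`UTabOK utab n`, `IntegerScrewCensusUTabDigits`) and
`CL ≤ 2^162 ζ(2,¼) ≤ CH`, then `ManifestCert n (1/10) T` (`Theorems/ScrewManifestCertDefs.lean`) holds with the witness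
`t_k = j_k/500`, `w_k = (Ω_k/2^60) t_k²`, `w_J = WJ/2^60`: the remainder `S_{n+1} − Σ_k w_k A_{t_k} − w_J J` is strictly
diagonally dominant (`dd_of_rowsOK`: per node, `2^164 Σ_{j≠i}|R_ij| ≤ sumN tri[i] + colSums[i] < diagLoN_i − 2·OZ − ZB
≤ 2^164 R_ii` from `pair_le`, symmetry and `diag_ge` of `IntegerScrewCensusFastNodes`).  Layers below: trig rows `rows_err`
(`…FastRowsInv`), packed integers `pair_num` (`…FastPair`), numerator error `num_err` (`…FastErr`), offset arithmetic
(`…FastOffset`), pieces (`…FastSound`).  RH-free; nothing here bears on the truth of RH.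
-/

set_option linter.dupNamespace false
set_option autoImplicit false

namespace Summit.RiemannHypothesis.RiemannHypothesis.Theorems.IntegerScrew.Manifest.Fast

open Finset
open Literature.Analysis.ValidatedNumerics Literature.Analysis.ValidatedNumerics.Numerics
open Literature.Analysis.ValidatedNumerics.KroneckerDot Literature.NumberTheory.LFunctions

/-! ### The row-sum argument -/

/-- **Strict diagonal dominance from the row tests.**  With `Rw` the trig rows (every node `2 ≤ m ≤ n+1` correct), `Ps` the
packed nodes, `tri` the lower triangle of pair bounds and the row tests `rowsOK` passed, the remainder of the witness is
strictly diagonally dominant: for node `i`, `2^164 Σ_{j≠i} |R_ij| ≤ Σ_{j<i} tri[i][j] + Σ_{r>i} tri[r][i]` (pair bounds and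
symmetry) `= sumN tri[i] + colSums[i] < diagLoN_i − 2·OZ − ZB ≤ 2^164 R_ii`. -/
theorem dd_of_rowsOK {n K E1 Wmax WJ CL CH POS G1 G2 WJS2 : ℕ} {js oms : List ℕ} {utab urows : List (List (ℕ × ℕ))}
    {Rw : List (ℕ × List (ℕ × ℕ))} {Ps : List NodeP} {tri : List (List ℕ)}
    (hPOS : POS = 2 ^ 104 * (sumN oms + WJ) + 2 * K * (D0 * D1) + 2 ^ 53 * K * D0) (hG1 : G1 = CL + 2 * ZB - POS)
    (hG2 : G2 = CH + 2 * ZB - POS) (hWJS2 : WJS2 = 2 ^ 104 * (2 * sumN oms + WJ) + 2 ^ 53 * K * D0)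
    (hurows : urows = (utab.drop 2).take n) (hPs : Ps = packAllB E1 oms (Rw.drop 2) urows)
    (htri : tri = lowTri (WB * (K - 1)) G1 G2 Ps Ps urows)
    (hK1 : 1 ≤ K) (hK2 : K ≤ 512) (hKjs : js.length = K) (hKoms : oms.length = K) (ho : OmSmall oms)
    (hpos : ∀ k, k < K → 0 < js.getD k 0) (hU : ∀ k, k < K → Uk Wmax 500 (js.getD k 0) ≤ 1 / 26)
    (hE : 2 ^ 104 * ∑ k ∈ range K, (oms.getD k 0 : ℝ) * Uk Wmax 500 (js.getD k 0) ≤ E1) (hE1 : E1 ≤ 2 ^ 167)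
    (hWJ : WJ < 2 ^ 60) (hCL : (CL : ℝ) ≤ 2 ^ 162 * RungCert.lerchC) (hCH : 2 ^ 162 * RungCert.lerchC ≤ CH)
    (hutab : UTabOK utab n) (hutl : n + 2 ≤ utab.length) (hRlen : Rw.length = n + 2)
    (hRok : ∀ m, 2 ≤ m → m ≤ n + 1 → RowOK Wmax 500 js m (Rw.getD m (0, [])))
    (hrows : rowsOK CL WJS2 E1 Ps tri (colSums tri) = true) :
    IsStrictDiagDominant (remainder n K (fun k : Fin K => (js.getD k 0 : ℝ) / 500)
      (fun k : Fin K => (oms.getD k 0 : ℝ) / 2 ^ 60 * ((js.getD k 0 : ℝ) / 500) ^ 2) ((WJ : ℝ) / 2 ^ 60)) := by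
  intro i
  have hi : (i : ℕ) < n := i.isLt
  -- a default node for `getD`
  let dP : NodeP := packNodeB 0 [] (0, []) (0, 0)
  -- lengths
  have hul : urows.length = n := by rw [hurows, List.length_take, List.length_drop]; omega
  have hdl : (Rw.drop 2).length = n := by rw [List.length_drop, hRlen]; omega
  have hPl : Ps.length = n := by rw [hPs, packAllB_length E1 oms _ _ (by rw [hdl, hul]), hdl]
  have htl : tri.length = n := by rw [htri, lowTri_length _ _ _ Ps Ps urows (by rw [hPl, hul]), hPl]
  -- the packed nodes, the u-table rows, the triangle rows and entries
  have hP : ∀ m, m < n →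
      Ps.getD m dP = packNodeB E1 oms (Rw.getD (m + 2) (0, [])) ((utab.getD (m + 2) []).getD 1 (0, 0)) := by
    intro m hm
    rw [hPs, packAllB_getD E1 oms dP _ _ m (by rw [hdl]; exact hm) (by rw [hdl, hul]), getD_drop_two, hurows,
      getD_urows utab hm]
  have hrowU : ∀ m, m < n → (utab.getD (m + 2) []).length = m + 2 :=
    fun m hm => (hutab (m + 2) (by omega) (by omega)).1
  have hu : ∀ m b, m < n → 1 ≤ b → b < m + 2 →
      ((((utab.getD (m + 2) []).getD b (0, 0)).1 : ℕ) : ℝ) ≤ 2 ^ 164 * RungCert.uR (m + 2) b + OZ ∧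
      2 ^ 164 * RungCert.uR (m + 2) b + OZ ≤ ((((utab.getD (m + 2) []).getD b (0, 0)).2 : ℕ) : ℝ) ∧
      ((utab.getD (m + 2) []).getD b (0, 0)).2 < 2 ^ 174 :=
    fun m b hm hb hbm => (hutab (m + 2) (by omega) (by omega)).2 b hb hbm
  have hT : ∀ m, m < n → tri.getD m [] =
      lowRow (WB * (K - 1)) (G1 + (Ps.getD m dP).xa) (G2 + (Ps.getD m dP).ya) (Ps.getD m dP) Ps
        ((utab.getD (m + 2) []).drop 2) := by
    intro m hm
    rw [htri, lowTri_getD _ G1 G2 Ps dP Ps urows m (by rw [hPl]; exact hm) (by rw [hPl, hul]), hurows,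
      getD_urows utab hm]
  have hTlen : ∀ m, m < n → (tri.getD m []).length = m := by
    intro m hm
    rw [hT m hm, lowRow_length _ _ _ _ Ps _ (by rw [List.length_drop, hrowU m hm, hPl]; omega), List.length_drop,
      hrowU m hm]
    omega
  have hTget : ∀ m j, j < m → m < n → (tri.getD m []).getD j 0 =
      pairAbs (WB * (K - 1)) (G1 + (Ps.getD m dP).xa) (G2 + (Ps.getD m dP).ya) (Ps.getD m dP) (Ps.getD j dP)
        ((utab.getD (m + 2) []).getD (j + 2) (0, 0)) := by
    intro m j hjm hm
    rw [hT m hm, lowRow_getD _ _ _ _ dP Ps _ j (by rw [List.length_drop, hrowU m hm]; omega)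
      (by rw [List.length_drop, hrowU m hm, hPl]; omega), getD_drop_two]
  -- the pair bounds
  have hpair : ∀ m j : Fin n, (j : ℕ) < m →
      2 ^ 164 * |remainder n K (fun k : Fin K => (js.getD k 0 : ℝ) / 500)
          (fun k : Fin K => (oms.getD k 0 : ℝ) / 2 ^ 60 * ((js.getD k 0 : ℝ) / 500) ^ 2) ((WJ : ℝ) / 2 ^ 60) m j| ≤ (((tri.getD m []).getD j 0 : ℕ) : ℝ) := by
    intro m j hjm
    rw [hTget m j hjm m.isLt, hP m m.isLt, hP j j.isLt]
    obtain ⟨hua1, hua2, -⟩ := hu m 1 m.isLt le_rfl (by omega)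
    obtain ⟨hub1, hub2, -⟩ := hu j 1 j.isLt le_rfl (by omega)
    obtain ⟨huab1, huab2, huab3⟩ := hu m ((j : ℕ) + 2) m.isLt (by omega) (by omega)
    exact pair_le m j hjm hPOS hG1 hG2 hK1 hK2 hKjs hKoms ho hpos hU (hRok _ (by omega) (by omega))
      (hRok _ (by omega) (by omega)) hE hE1 hWJ hCL hCH hua1 hua2 hub1 hub2 huab1 huab2 huab3
  -- the row test and the diagonal bound
  have hrow := rowsOK_spec CL WJS2 E1 dP Ps tri (colSums tri) hrows i (by rw [hPl]; exact hi)
  have hDpos : 0 < diagLoN CL WJS2 E1 (Ps.getD i dP) := by omega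
  have hdiag : ((diagLoN CL WJS2 E1 (Ps.getD i dP) : ℕ) : ℝ) ≤ 2 ^ 164 * remainder n K (fun k : Fin K => (js.getD k 0 : ℝ) / 500)
          (fun k : Fin K => (oms.getD k 0 : ℝ) / 2 ^ 60 * ((js.getD k 0 : ℝ) / 500) ^ 2) ((WJ : ℝ) / 2 ^ 60) i i + 2 * OZ + ZB := by
    rw [hP i hi] at hDpos ⊢
    exact diag_ge i hKjs hKoms ho hpos hU (hRok _ (by omega) (by omega)) hE hCL (hu i 1 hi le_rfl (by omega)).1
      hWJS2 hDpos
  -- the sums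
  have hsym := remainder_symm (n := n) (WJ := WJ) (oms := oms) hpos
  have hS1 : ((sumN (tri.getD i []) : ℕ) : ℝ) = ∑ j ∈ range n, (((tri.getD i []).getD j 0 : ℕ) : ℝ) := by
    rw [sumN_eq_sum_range (N := n) (by rw [hTlen i hi]; exact hi.le)]
    push_cast
    rfl
  have hS2 : (((colSums tri).getD i 0 : ℕ) : ℝ) = ∑ r ∈ range n, (((tri.getD r []).getD i 0 : ℕ) : ℝ) := by
    rw [getD_colSums, htl]
    push_cast
    rfl
  have hterm : ∀ j : Fin n, j ≠ i →
      2 ^ 164 * |remainder n K (fun k : Fin K => (js.getD k 0 : ℝ) / 500)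
          (fun k : Fin K => (oms.getD k 0 : ℝ) / 2 ^ 60 * ((js.getD k 0 : ℝ) / 500) ^ 2) ((WJ : ℝ) / 2 ^ 60) i j| ≤ (((tri.getD i []).getD j 0 : ℕ) : ℝ) + (((tri.getD j []).getD i 0 : ℕ) : ℝ) := by
    intro j hji
    rcases lt_or_gt_of_ne (Fin.val_ne_of_ne hji) with hlt | hgt
    · have h1 := hpair i j hlt
      have h0 : (0 : ℝ) ≤ (((tri.getD j []).getD i 0 : ℕ) : ℝ) := Nat.cast_nonneg _
      linarith
    · have h1 := hpair j i hgt
      rw [hsym i j]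
      have h0 : (0 : ℝ) ≤ (((tri.getD i []).getD j 0 : ℕ) : ℝ) := Nat.cast_nonneg _
      linarith
  have hsum : 2 ^ 164 * ∑ j ∈ univ.erase i, |remainder n K (fun k : Fin K => (js.getD k 0 : ℝ) / 500)
          (fun k : Fin K => (oms.getD k 0 : ℝ) / 2 ^ 60 * ((js.getD k 0 : ℝ) / 500) ^ 2) ((WJ : ℝ) / 2 ^ 60) i j| ≤
      ((sumN (tri.getD i []) : ℕ) : ℝ) + (((colSums tri).getD i 0 : ℕ) : ℝ) := by
    rw [Finset.mul_sum, hS1, hS2, ← Finset.sum_add_distrib,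
      ← Fin.sum_univ_eq_sum_range (fun j => (((tri.getD i []).getD j 0 : ℕ) : ℝ) +
        (((tri.getD j []).getD i 0 : ℕ) : ℝ)) n]
    calc ∑ j ∈ univ.erase i, 2 ^ 164 * |remainder n K (fun k : Fin K => (js.getD k 0 : ℝ) / 500)
          (fun k : Fin K => (oms.getD k 0 : ℝ) / 2 ^ 60 * ((js.getD k 0 : ℝ) / 500) ^ 2) ((WJ : ℝ) / 2 ^ 60) i j|
        ≤ ∑ j ∈ univ.erase i, ((((tri.getD i []).getD j 0 : ℕ) : ℝ) + (((tri.getD j []).getD i 0 : ℕ) : ℝ)) :=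
          Finset.sum_le_sum fun j hj => hterm j (Finset.ne_of_mem_erase hj)
      _ ≤ ∑ j : Fin n, ((((tri.getD i []).getD j 0 : ℕ) : ℝ) + (((tri.getD j []).getD i 0 : ℕ) : ℝ)) :=
          Finset.sum_le_sum_of_subset_of_nonneg (Finset.erase_subset _ _) fun j _ _ => by positivity
  have hrowR : ((sumN (tri.getD i []) : ℕ) : ℝ) + (((colSums tri).getD i 0 : ℕ) : ℝ) + 2 * OZ + ZB <
      ((diagLoN CL WJS2 E1 (Ps.getD i dP) : ℕ) : ℝ) := by
    exact_mod_cast hrow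
  have h2 : (0 : ℝ) ≤ 2 ^ 164 := by positivity
  exact lt_of_mul_lt_mul_left (by linarith) h2

/-! ### The soundness theorem -/

/-- The rows list has `n + 2` entries. -/
theorem rows_length (tcs : List ℕ) (logs : List FI) (τ : ℕ) (js : List ℕ) (n : ℕ) :
    (rows tcs logs τ js n).1.length = n + 2 := by
  unfold rows
  rw [buildRows_length]
  simp

/-- **SOUNDNESS OF THE FAST CHECKER.**  If the log table encloses `log m` for `m ≤ n + 1`, the scaled-digit u-table is
valid to node `n + 1`, `CL ≤ 2^162·ζ(2,¼) ≤ CH`, and both `fastLight n logs utab js oms WJ T CL CH` and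
`fastCheckB n logs utab js oms WJ CL CH` return `true`, then `ManifestCert n (1/10) T`: the screw matrix `S_{n+1}` minus the
wave atoms `t_k = j_k/500 ∈ [1/10, T]` with weights `(Ω_k/2^60)·t_k²` minus `(WJ/2^60)·J` is strictly diagonally dominant. -/
theorem manifestCert_of_fastCheckB {n T CL CH WJ : ℕ} {logs : List FI} {utab : List (List (ℕ × ℕ))} {js oms : List ℕ}
    (hlogs : ∀ m, m ≤ n + 1 → FI.mem (Real.log m) (logs.getD m (FI.ofInt 0)))
    (hutab : UTabOK utab n) (hCL : (CL : ℝ) ≤ 2 ^ 162 * RungCert.lerchC) (hCH : 2 ^ 162 * RungCert.lerchC ≤ CH)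
    (hlight : fastLight n logs utab js oms WJ T CL CH = true)
    (hcheck : fastCheckB n logs utab js oms WJ CL CH = true) : ManifestCert n (1 / 10 : ℝ) (T : ℝ) := by
  -- the light test
  unfold fastLight at hlight
  simp only [Bool.and_eq_true, decide_eq_true_eq, List.all_eq_true] at hlight
  obtain ⟨⟨⟨⟨⟨⟨⟨⟨⟨⟨⟨hn1, hn2⟩, hlen⟩, hK1⟩, hK2⟩, hjs⟩, homs⟩, hWJ⟩, hWmax⟩, -⟩, -⟩, hutl⟩ := hlight
  -- the checker
  have hc := hcheck
  unfold fastCheckB at hc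
  simp only [Bool.and_eq_true, Nat.add_eq, Nat.mul_eq, Nat.sub_eq] at hc
  rw [rowsD_eq, tcLitN_eq] at hc
  obtain ⟨hflag, hrows⟩ := hc
  -- hypotheses of the row-sum argument
  have ho : OmSmall oms := fun o h => homs o h
  have hmem : ∀ k, k < js.length → js.getD k 0 ∈ js := fun k hk => by
    rw [List.getD_eq_getElem _ _ hk]; exact List.getElem_mem hk
  have hpos : ∀ k, k < js.length → 0 < js.getD k 0 := fun k hk => by
    have := (hjs _ (hmem k hk)).1.1.1; omega
  have hU : ∀ k, k < js.length → Uk (maxLogWidth logs (n + 1)) 500 (js.getD k 0) ≤ 1 / 26 :=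
    fun k hk => Uk_le_of_light (hjs _ (hmem k hk)).2
  have hE := errUnit_ge (maxLogWidth logs (n + 1)) js oms hlen
  have hE1 := errUnit_le hWmax (fun j hj => (hjs j hj).1.2) ho hK2
  have hlogs' : ∀ m, 2 ≤ m → m ≤ n + 1 →
      FI.mem (Real.log m) (logs.getD m (FI.ofInt 0)) ∧ (logLoW logs m).2 ≤ maxLogWidth logs (n + 1) :=
    fun m h2 hm => ⟨hlogs m hm, logLoW_le_maxLogWidth logs hm (by omega)⟩
  have hRok : ∀ m, 2 ≤ m → m ≤ n + 1 →
      RowOK (maxLogWidth logs (n + 1)) 500 js m ((rows tcList logs 500 js n).1.getD m (0, [])) :=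
    fun m h2 hm => rows_err (by norm_num) hlogs' hU hflag h2 hm
  -- the witness
  refine ⟨js.length, fun k => (js.getD k 0 : ℝ) / 500,
    fun k => (oms.getD k 0 : ℝ) / 2 ^ 60 * ((js.getD k 0 : ℝ) / 500) ^ 2, (WJ : ℝ) / 2 ^ 60, fun k => ?_,
    by positivity, ?_⟩
  · obtain ⟨⟨⟨h50, hT⟩, -⟩, -⟩ := hjs _ (hmem k k.isLt)
    have h50' : (50 : ℝ) ≤ js.getD k 0 := by exact_mod_cast h50
    have hT' : (js.getD k 0 : ℝ) ≤ 500 * T := by exact_mod_cast hT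
    refine ⟨?_, ?_, by positivity, by positivity⟩
    · rw [le_div_iff₀ (by norm_num)]; linarith
    · rw [div_le_iff₀ (by norm_num)]; linarith
  · exact dd_of_rowsOK rfl rfl rfl rfl rfl rfl rfl hK1 hK2 rfl hlen.symm ho hpos hU hE hE1 hWJ hCL hCH hutab hutl
      (rows_length _ _ _ _ _) hRok hrows

end Summit.RiemannHypothesis.RiemannHypothesis.Theorems.IntegerScrew.Manifest.Fast
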